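import Mathlib
import Summits.AtomisticToContinuum.Crystallization.Theses.PhononSlackCertificates
import Summits.AtomisticToContinuum.Crystallization.Theorems.ChargedEnergyGap.Negative.Unconditional
import Summits.AtomisticToContinuum.Crystallization.Theorems.OnePercentCertificate.Negative.TwoConeSABound
import Summits.AtomisticToContinuum.Crystallization.Theorems.PhononSlackCertificatesNearFarGlueRFibre
import Summits.AtomisticToContinuum.Crystallization.Theorems.PhononSlackCertificatesNearFarGlueRHcpBoxSubset
import Literature.MathematicalPhysics.StatisticalMechanics.LennardJonesClusters

/-!
# Crux `PhononSlackCertificates.NearFarGlueR` (stmt-AtomisticToContinuum-14970), line `Sketch`: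
the insertion principle and the HOLE species of the residual (lattice-free)

Continuation lead c4.  The registered residual of the line is the tight contact gap (every bad
particle next to good crystal pays `g₂ > 0` against `N·e*`, `e* = ⨅_Q e(Q)`).  Leads c0–c3
recorded that the tree offers only UPPER handles on `e*` (periodisation `N·e* ≤ 𝓔(y)`,
`e* ≤ e(Q)`, `e* ≤ −0.711`) and the crude floor `e* ≥ −2³²/12`, so that no argument in which `e*`
enters with a positive sign was available.  This is no longer so: the tree holds the two-cone
(Fisher–Ruelle/Bochner) stability bound `Σ_{i<j} V_LJ ≥ −(98309653/125000000)·N ≈ −0.7865·N`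
for every finite configuration of distinct points (`TwoConeSA.twoConeS_stability`, landed
2026-08-16), i.e. a floor on `e*` within `10 %` of its value `≈ −0.7175`.  This file turns it into

* the **floor** `e* ≥ −98309653/125000000` (`neg_twoCone_le_eStar`, through the proved energy
  limit `E(N)/N → e*`);
* the **insertion principle** (`insertion_principle`): for every finite injective `x`, every
  injective family of test points `p` off the configuration,
  `(N + m)·e* ≤ 𝓔(x) + 𝓔(p) + Σ_i Σ_l V(|x_i − p_l|)` — periodisation of the enlarged
  configuration `x ⊕ p`; dual to c3's removal principle;
* the **hole species** (`holes_gap` = registered sub-goal `stub_holesGap`): if the test points are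
  pairwise `≥ 9/10` apart (so `𝓔(p) ≤ 0`) and a test particle at each `p_l` would bind with
  `W_{p_l}(x) = Σ_i V(|p_l − x_i|) ≤ −98309653/125000000 − g`, then `N·e* + g·m ≤ 𝓔_LJ(x)`.
  A vacant site whose first shell is occupied at distances in `[0.95, 1.1]` already has
  `W ≤ 12·V(1.1) < −0.80`; with the second shell `W ≲ −1.0`, and an unrelaxed vacancy of a crystal
  at scale `a ∈ [47/50, 1]` has `W = 2e(fcc_a) ∈ [−1.44, −1.36]`: every vacancy, divacancy or
  small vacancy cluster in ANY environment — relaxed, strained, polycrystalline, finite — pays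
  `≥ 0.2` (resp. `≥ 0.57` unrelaxed), with NO reference lattice and no knowledge of `e*` beyond
  the two certified cones `−0.7865 ≤ e* ≤ −0.711`;
* the count transfer to the route's vocabulary (`card_near_holes_le`, `holes_gap_near`,
  `tightContactGap_ineq_holes`): in a `δ`-separated configuration at most `(2R/δ+1)³` particles
  lie within `R` of one hole, so `N·e* + g/(2R/δ+1)³ · #{j : x_j within R of a deep hole} ≤ 𝓔(x)`;
  in particular the tight contacts created by vacancies (the `12 + 6` neighbours of the vacant
  site, all bad, all adjacent to good crystal) are priced.

What this does NOT reach (recorded so nobody retries it): free surfaces and internal voids wider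
than one shell (the vacant sites there bind a test particle by `≈ 3–9` bonds only, `W > −0.79`),
strained or displaced cages without a vacant site, grain boundaries without free volume — the
well-bonded, hole-free interface, which needs `e*` to `~1e-3` or phonon coercivity AT the
interface.  All `[folklore]`.
-/

noncomputable section

namespace Summit.AtomisticToContinuum.Crystallization.Theorems.PhononSlackCertificatesNearFarGlueR

open Literature.MathematicalPhysics.StatisticalMechanics
open Literature.Geometry.DiscreteGeometry
open Summit.AtomisticToContinuum.Crystallization.Theses.PhononSlackCertificates
open Summit.AtomisticToContinuum.Crystallization.Theorems.ChargedEnergyGapNegative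
  (eStar card_mul_eStar_le crysEnergyLimit)
open scoped BigOperators

/-! ## §0 The two-cone floor on `e*` -/

/-- **Floor on the periodic infimum**: `e* = ⨅_Q e(Q) ≥ −98309653/125000000 ≈ −0.7865`, from the
tree's two-cone stability bound `E(N) ≥ −(98309653/125000000)·N` (`TwoConeSA`) and the proved
energy limit `E(N)/N → e*`. [folklore] -/
theorem neg_twoCone_le_eStar :
    -(98309653 / 125000000 : ℝ) ≤ ⨅ Q : PeriodicConfiguration 3, Q.energyPerParticle lennardJones :=
  ge_of_tendsto crysEnergyLimit (Filter.eventually_atTop.2 ⟨1, fun N hN => by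
    have h := TwoConeSA.twoConeS_groundStateEnergy_ge N
    have hN' : (0 : ℝ) < N := by exact_mod_cast hN
    rw [le_div_iff₀ hN']
    linarith⟩)

/-! ## §1 The insertion principle -/

/-- Juxtaposing an injective configuration with an injective family of points off it gives an
injective configuration. [folklore] -/
theorem append_injective {N m : ℕ} {x : Fin N → EuclideanSpace ℝ (Fin 3)}
    (hx : Function.Injective x) {p : Fin m → EuclideanSpace ℝ (Fin 3)} (hp : Function.Injective p)
    (hoff : ∀ (l : Fin m) (i : Fin N), p l ≠ x i) : Function.Injective (Fin.append x p) := by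
  intro a b hab
  induction a using Fin.addCases with
  | left i =>
    induction b using Fin.addCases with
    | left i' =>
      rw [Fin.append_left, Fin.append_left] at hab
      rw [hx hab]
    | right l' =>
      rw [Fin.append_left, Fin.append_right] at hab
      exact absurd hab.symm (hoff l' i)
  | right l =>
    induction b using Fin.addCases with
    | left i' =>
      rw [Fin.append_right, Fin.append_left] at hab
      exact absurd hab (hoff l i')
    | right l' =>
      rw [Fin.append_right, Fin.append_right] at hab
      rw [hp hab]

/-- **Insertion principle.**  For every finite injective configuration `x` of `ℝ³` and every
injective family `p` of `m` test points off the configuration,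
`(N + m)·e* ≤ 𝓔_LJ(x) + 𝓔_LJ(p) + Σ_i Σ_l V(|x_i − p_l|)`: periodisation (`card_mul_eStar_le`) of
the enlarged configuration `x ⊕ p` and the two-cluster identity `interactionEnergy_append`.  Dual
to the removal principle; here `e*` enters with a POSITIVE sign, so it is the floor on `e*` that
turns it into a gap. [folklore] -/
theorem insertion_principle {N m : ℕ} (x : Fin N → EuclideanSpace ℝ (Fin 3))
    (hx : Function.Injective x) (p : Fin m → EuclideanSpace ℝ (Fin 3)) (hp : Function.Injective p)
    (hoff : ∀ (l : Fin m) (i : Fin N), p l ≠ x i) :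
    ((N : ℝ) + m) * (⨅ Q : PeriodicConfiguration 3, Q.energyPerParticle lennardJones) ≤
      interactionEnergy lennardJones x + interactionEnergy lennardJones p +
        ∑ i, ∑ l, lennardJones (dist (x i) (p l)) := by
  have h := card_mul_eStar_le (append_injective hx hp hoff)
  rw [interactionEnergy_append lennardJones lennardJones_zero x p] at h
  change ((N : ℝ) + m) * eStar ≤ _
  have hcast : (((N + m : ℕ) : ℝ)) = (N : ℝ) + m := by push_cast; ring
  rw [hcast] at h
  exact h

/-! ## §2 Deep holes pay -/

/-- A family of points pairwise `≥ 9/10` apart has non-positive Lennard-Jones energy.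
[folklore] -/
theorem interactionEnergy_nonpos_of_sep {m : ℕ} (p : Fin m → EuclideanSpace ℝ (Fin 3))
    (hsep : ∀ l l' : Fin m, l ≠ l' → (9 / 10 : ℝ) ≤ dist (p l) (p l')) :
    interactionEnergy lennardJones p ≤ 0 := by
  unfold interactionEnergy
  refine Finset.sum_nonpos fun l _ => Finset.sum_nonpos fun l' hl' => ?_
  exact lennardJones_nonpos_of_ge_nine_tenths (hsep l l' (ne_of_lt (Finset.mem_Ioi.1 hl')))

/-- **Deep holes pay** (general floor).  If `−B ≤ e*`, the test points `p` are pairwise `≥ 9/10`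
apart and off the injective configuration `x`, and a test particle at each `p_l` would bind with
`W_{p_l}(x) = Σ_i V(|p_l − x_i|) ≤ −B − g`, then `N·e* + g·m ≤ 𝓔_LJ(x)`. [folklore] -/
theorem holes_gap_of_floor {B : ℝ}
    (hB : -B ≤ ⨅ Q : PeriodicConfiguration 3, Q.energyPerParticle lennardJones)
    {N m : ℕ} (x : Fin N → EuclideanSpace ℝ (Fin 3)) (hx : Function.Injective x)
    (p : Fin m → EuclideanSpace ℝ (Fin 3)) (g : ℝ)
    (hsep : ∀ l l' : Fin m, l ≠ l' → (9 / 10 : ℝ) ≤ dist (p l) (p l'))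
    (hoff : ∀ (l : Fin m) (i : Fin N), p l ≠ x i)
    (hdeep : ∀ l : Fin m, ∑ i, lennardJones (dist (p l) (x i)) ≤ -B - g) :
    (N : ℝ) * (⨅ Q : PeriodicConfiguration 3, Q.energyPerParticle lennardJones) + g * (m : ℝ) ≤
      interactionEnergy lennardJones x := by
  have hp : Function.Injective p := fibre_injective_of_separated (by norm_num) hsep
  have hins := insertion_principle x hx p hp hoff
  have hEp := interactionEnergy_nonpos_of_sep p hsep
  -- the cross sum, summed over the holes first
  have hcross : ∑ i, ∑ l, lennardJones (dist (x i) (p l)) ≤ (m : ℝ) * (-B - g) := by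
    rw [Finset.sum_comm]
    have h1 : ∑ l : Fin m, ∑ i : Fin N, lennardJones (dist (x i) (p l)) ≤
        ∑ _l : Fin m, (-B - g) := by
      refine Finset.sum_le_sum fun l _ => ?_
      have := hdeep l
      simpa only [dist_comm] using this
    have h2 : ∑ _l : Fin m, (-B - g) = (m : ℝ) * (-B - g) := by
      rw [Finset.sum_const, Finset.card_univ, Fintype.card_fin, nsmul_eq_mul]
    linarith
  have hm0 : (0 : ℝ) ≤ m := Nat.cast_nonneg _
  have hmB : (m : ℝ) * (-B) ≤ (m : ℝ) * (⨅ Q : PeriodicConfiguration 3,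
      Q.energyPerParticle lennardJones) := mul_le_mul_of_nonneg_left hB hm0
  nlinarith [hins, hEp, hcross, hmB]

/-- **Deep holes pay** — registered sub-goal `stub_holesGap`-shaped statement with the tree's
two-cone floor `B = 98309653/125000000 ≈ 0.7865`: for every finite injective `x`, every
`9/10`-separated family of points `p` off the configuration and every `g`, if
`W_{p_l}(x) ≤ −98309653/125000000 − g` for every `l` then `N·e* + g·m ≤ 𝓔_LJ(x)`.  A vacant site
with a reasonably complete first and second shell has `W ≲ −1.0`, an unrelaxed lattice vacancy
`W = 2e(fcc_a) ≤ −1.36`: vacancies pay `≥ 0.2`, in ANY environment, lattice-free. [folklore] -/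
theorem holes_gap {N m : ℕ} (x : Fin N → EuclideanSpace ℝ (Fin 3)) (hx : Function.Injective x)
    (p : Fin m → EuclideanSpace ℝ (Fin 3)) (g : ℝ)
    (hsep : ∀ l l' : Fin m, l ≠ l' → (9 / 10 : ℝ) ≤ dist (p l) (p l'))
    (hoff : ∀ (l : Fin m) (i : Fin N), p l ≠ x i)
    (hdeep : ∀ l : Fin m, ∑ i, lennardJones (dist (p l) (x i)) ≤ -(98309653 / 125000000 : ℝ) - g) :
    (N : ℝ) * (⨅ Q : PeriodicConfiguration 3, Q.energyPerParticle lennardJones) + g * (m : ℝ) ≤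
      interactionEnergy lennardJones x :=
  holes_gap_of_floor neg_twoCone_le_eStar x hx p g hsep hoff hdeep

/-- **Registered sub-goal `stub_holesGap` of the crux item** (skeleton `Lines/Sketch.lean`, c4):
deep holes pay — the statement of `holes_gap` in closed form. [folklore] -/
theorem stub_holesGap :
    ∀ (N : ℕ) (x : Fin N → EuclideanSpace ℝ (Fin 3)), Function.Injective x →
    ∀ (m : ℕ) (p : Fin m → EuclideanSpace ℝ (Fin 3)) (g : ℝ),
      (∀ l l' : Fin m, l ≠ l' → (9 / 10 : ℝ) ≤ dist (p l) (p l')) →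
      (∀ (l : Fin m) (i : Fin N), p l ≠ x i) →
      (∀ l : Fin m, ∑ i, lennardJones (dist (p l) (x i)) ≤ -(98309653 / 125000000 : ℝ) - g) →
      (N : ℝ) * (⨅ Q : PeriodicConfiguration 3, Q.energyPerParticle lennardJones) + g * (m : ℝ)
        ≤ interactionEnergy lennardJones x :=
  fun _ x hx _ p g hsep hoff hdeep => holes_gap x hx p g hsep hoff hdeep

/-! ## §3 In the route's vocabulary: particles near deep holes are paid for -/

/-- **Count transfer**: in a `δ`-separated configuration, at most `(2R/δ+1)³·m` particles lie
within `R` of a family of `m` points (packing bound per point, union bound). [folklore] -/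
theorem card_near_holes_le {N m : ℕ} (x : Fin N → EuclideanSpace ℝ (Fin 3)) {δ R : ℝ}
    (hδ : 0 < δ) (hR : 0 ≤ R) (hsep : ∀ i j : Fin N, i ≠ j → δ ≤ dist (x i) (x j))
    (p : Fin m → EuclideanSpace ℝ (Fin 3)) :
    (Nat.card {j : Fin N // ∃ l : Fin m, dist (x j) (p l) ≤ R} : ℝ) ≤ (2 * R / δ + 1) ^ 3 * m := by
  classical
  set F : Fin m → Finset (Fin N) := fun l => Finset.univ.filter fun j => dist (x j) (p l) ≤ R
    with hF
  have hcard : (Nat.card {j : Fin N // ∃ l : Fin m, dist (x j) (p l) ≤ R} : ℝ) =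
      ((Finset.univ.filter fun j : Fin N => ∃ l : Fin m, dist (x j) (p l) ≤ R).card : ℝ) := by
    rw [Nat.card_eq_fintype_card, Fintype.card_subtype]
  rw [hcard]
  have hcover : (Finset.univ.filter fun j : Fin N => ∃ l : Fin m, dist (x j) (p l) ≤ R) ⊆
      Finset.univ.biUnion F := by
    intro j hj
    obtain ⟨l, hl⟩ := (Finset.mem_filter.1 hj).2
    exact Finset.mem_biUnion.2 ⟨l, Finset.mem_univ _, Finset.mem_filter.2 ⟨Finset.mem_univ _, hl⟩⟩
  have hfibre : ∀ l : Fin m, ((F l).card : ℝ) ≤ (2 * R / δ + 1) ^ 3 := by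
    intro l
    have hinj : Set.InjOn x (F l) := fun a _ b _ hab => by
      by_contra hne
      have := hsep a b hne
      rw [hab, dist_self] at this
      exact absurd this (not_le.2 hδ)
    rw [← Finset.card_image_of_injOn hinj]
    have h := card_le_of_separated_of_dist_le ((F l).image x) (p l) hδ hR ?_ ?_
    · rwa [finrank_euclideanSpace_fin] at h
    · intro c hc
      obtain ⟨j, hj, rfl⟩ := Finset.mem_image.1 hc
      exact (Finset.mem_filter.1 hj).2
    · intro c hc c' hc' hne
      obtain ⟨a, -, rfl⟩ := Finset.mem_image.1 hc
      obtain ⟨b, -, rfl⟩ := Finset.mem_image.1 hc'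
      exact hsep a b fun h => hne (h ▸ rfl)
  have h1 : (((Finset.univ.filter fun j : Fin N => ∃ l : Fin m, dist (x j) (p l) ≤ R).card : ℕ) : ℝ)
      ≤ ((Finset.univ.biUnion F).card : ℝ) := by exact_mod_cast Finset.card_le_card hcover
  have h2 : ((Finset.univ.biUnion F).card : ℝ) ≤ ∑ l, ((F l).card : ℝ) := by
    exact_mod_cast Finset.card_biUnion_le
  have h3 : ∑ l, ((F l).card : ℝ) ≤ ∑ _l : Fin m, (2 * R / δ + 1) ^ 3 :=
    Finset.sum_le_sum fun l _ => hfibre l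
  rw [Finset.sum_const, Finset.card_univ, Fintype.card_fin, nsmul_eq_mul] at h3
  linarith

/-- **Particles near deep holes pay** (general floor): in a `δ`-separated configuration,
`N·e* + g/(2R/δ+1)³ · #{j : x_j within R of one of the holes} ≤ 𝓔_LJ(x)` for every
`9/10`-separated family of holes off the configuration with `W ≤ −B − g`, `g ≥ 0`, given
`−B ≤ e*`. [folklore] -/
theorem holes_gap_near_of_floor {B : ℝ}
    (hB : -B ≤ ⨅ Q : PeriodicConfiguration 3, Q.energyPerParticle lennardJones)
    {N m : ℕ} (x : Fin N → EuclideanSpace ℝ (Fin 3)) {δ R g : ℝ} (hδ : 0 < δ) (hR : 0 ≤ R)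
    (hg : 0 ≤ g) (hsepx : ∀ i j : Fin N, i ≠ j → δ ≤ dist (x i) (x j))
    (p : Fin m → EuclideanSpace ℝ (Fin 3))
    (hsep : ∀ l l' : Fin m, l ≠ l' → (9 / 10 : ℝ) ≤ dist (p l) (p l'))
    (hoff : ∀ (l : Fin m) (i : Fin N), p l ≠ x i)
    (hdeep : ∀ l : Fin m, ∑ i, lennardJones (dist (p l) (x i)) ≤ -B - g) :
    (N : ℝ) * (⨅ Q : PeriodicConfiguration 3, Q.energyPerParticle lennardJones) +
        g / (2 * R / δ + 1) ^ 3 * (Nat.card {j : Fin N // ∃ l : Fin m, dist (x j) (p l) ≤ R} : ℝ) ≤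
      interactionEnergy lennardJones x := by
  have hgap := holes_gap_of_floor hB x (fibre_injective_of_separated hδ hsepx) p g hsep hoff hdeep
  have hcount := card_near_holes_le x hδ hR hsepx p
  have hK : 0 < (2 * R / δ + 1) ^ 3 := by positivity
  have h1 : g / (2 * R / δ + 1) ^ 3 *
      (Nat.card {j : Fin N // ∃ l : Fin m, dist (x j) (p l) ≤ R} : ℝ) ≤ g * m := by
    rw [div_mul_eq_mul_div, div_le_iff₀ hK]
    calc g * (Nat.card {j : Fin N // ∃ l : Fin m, dist (x j) (p l) ≤ R} : ℝ)
        ≤ g * ((2 * R / δ + 1) ^ 3 * m) := mul_le_mul_of_nonneg_left hcount hg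
      _ = g * m * (2 * R / δ + 1) ^ 3 := by ring
  linarith

/-- **Particles near deep holes pay** (two-cone floor): in a `δ`-separated configuration,
`N·e* + g/(2R/δ+1)³ · #{j : x_j within R of one of the holes} ≤ 𝓔_LJ(x)` for every
`9/10`-separated family of holes off the configuration with
`W ≤ −98309653/125000000 − g`, `g ≥ 0`. [folklore] -/
theorem holes_gap_near {N m : ℕ} (x : Fin N → EuclideanSpace ℝ (Fin 3)) {δ R g : ℝ}
    (hδ : 0 < δ) (hR : 0 ≤ R) (hg : 0 ≤ g) (hsepx : ∀ i j : Fin N, i ≠ j → δ ≤ dist (x i) (x j))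
    (p : Fin m → EuclideanSpace ℝ (Fin 3))
    (hsep : ∀ l l' : Fin m, l ≠ l' → (9 / 10 : ℝ) ≤ dist (p l) (p l'))
    (hoff : ∀ (l : Fin m) (i : Fin N), p l ≠ x i)
    (hdeep : ∀ l : Fin m, ∑ i, lennardJones (dist (p l) (x i)) ≤ -(98309653 / 125000000 : ℝ) - g) :
    (N : ℝ) * (⨅ Q : PeriodicConfiguration 3, Q.energyPerParticle lennardJones) +
        g / (2 * R / δ + 1) ^ 3 * (Nat.card {j : Fin N // ∃ l : Fin m, dist (x j) (p l) ≤ R} : ℝ) ≤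
      interactionEnergy lennardJones x :=
  holes_gap_near_of_floor neg_twoCone_le_eStar x hδ hR hg hsepx p hsep hoff hdeep

/-- **The residual's inequality restricted to tight contacts near deep holes.**  For a
`δ`-separated `x` and a `9/10`-separated family of deep holes (`W ≤ −98309653/125000000 − g`,
`g ≥ 0`) off the configuration:
`N·e* + g/(2R/δ+1)³ · #{j bad, within 21/20 of a good particle, within R of a hole} ≤ 𝓔_LJ(x)` —
the hole species of the registered residual `stub_tightContactGap`, unconditionally. [folklore] -/
theorem tightContactGap_ineq_holes {N m : ℕ} (x : Fin N → EuclideanSpace ℝ (Fin 3)) {δ R g : ℝ}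
    (hδ : 0 < δ) (hR : 0 ≤ R) (hg : 0 ≤ g) (hsepx : ∀ i j : Fin N, i ≠ j → δ ≤ dist (x i) (x j))
    (p : Fin m → EuclideanSpace ℝ (Fin 3))
    (hsep : ∀ l l' : Fin m, l ≠ l' → (9 / 10 : ℝ) ≤ dist (p l) (p l'))
    (hoff : ∀ (l : Fin m) (i : Fin N), p l ≠ x i)
    (hdeep : ∀ l : Fin m, ∑ i, lennardJones (dist (p l) (x i)) ≤ -(98309653 / 125000000 : ℝ) - g) :
    (N : ℝ) * (⨅ Q : PeriodicConfiguration 3, Q.energyPerParticle lennardJones) +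
        g / (2 * R / δ + 1) ^ 3 *
          (Nat.card {j : Fin N // (¬ IsTwoShellGood (1 / 20) (47 / 50) 1 x j ∧
            ∃ i : Fin N, IsTwoShellGood (1 / 20) (47 / 50) 1 x i ∧ dist (x i) (x j) ≤ 21 / 20) ∧
            ∃ l : Fin m, dist (x j) (p l) ≤ R} : ℝ) ≤
      interactionEnergy lennardJones x := by
  classical
  have h := holes_gap_near x hδ hR hg hsepx p hsep hoff hdeep
  have hmono : (Nat.card {j : Fin N // (¬ IsTwoShellGood (1 / 20) (47 / 50) 1 x j ∧
      ∃ i : Fin N, IsTwoShellGood (1 / 20) (47 / 50) 1 x i ∧ dist (x i) (x j) ≤ 21 / 20) ∧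
      ∃ l : Fin m, dist (x j) (p l) ≤ R} : ℝ) ≤
      (Nat.card {j : Fin N // ∃ l : Fin m, dist (x j) (p l) ≤ R} : ℝ) := by
    rw [Nat.card_eq_fintype_card, Fintype.card_subtype, Nat.card_eq_fintype_card,
      Fintype.card_subtype]
    refine Nat.cast_le.2 (Finset.card_le_card fun j hj => ?_)
    simp only [Finset.mem_filter, Finset.mem_univ, true_and] at hj ⊢
    exact hj.2
  have hK : 0 ≤ g / (2 * R / δ + 1) ^ 3 := by positivity
  nlinarith [mul_le_mul_of_nonneg_left hmono hK]

/-! ## §4 Arbitrary finite sets of deep holes (greedy `9/10`-net) -/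

/-- **Greedy net.**  Every finite set of points of `ℝ³` contains an `r`-separated subset within
distance `< r` of each of its points (`r > 0`). [folklore] -/
theorem exists_separated_net (A : Finset (EuclideanSpace ℝ (Fin 3))) {r : ℝ} (hr : 0 < r) :
    ∃ S ⊆ A, (∀ a ∈ S, ∀ b ∈ S, a ≠ b → r ≤ dist a b) ∧ ∀ a ∈ A, ∃ s ∈ S, dist a s < r := by
  classical
  induction A using Finset.induction_on with
  | empty => exact ⟨∅, by simp, by simp, by simp⟩
  | insert a A _ ih =>
    obtain ⟨S, hSA, hsep, hcov⟩ := ih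
    by_cases h : ∃ s ∈ S, dist a s < r
    · refine ⟨S, hSA.trans (Finset.subset_insert _ _), hsep, fun b hb => ?_⟩
      rcases Finset.mem_insert.1 hb with rfl | hb
      · exact h
      · exact hcov b hb
    · push Not at h
      refine ⟨insert a S, Finset.insert_subset_insert _ hSA, fun u hu v hv huv => ?_, fun b hb => ?_⟩
      · simp only [Finset.mem_insert] at hu hv
        rcases hu with rfl | hu'
        · rcases hv with rfl | hv'
          · exact absurd rfl huv
          · exact h v hv'
        · rcases hv with rfl | hv'
          · rw [dist_comm]; exact h u hu'
          · exact hsep u hu' v hv' huv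
      · rcases Finset.mem_insert.1 hb with rfl | hb
        · exact ⟨b, Finset.mem_insert_self _ _, by rw [dist_self]; exact hr⟩
        · obtain ⟨s, hs, hd⟩ := hcov b hb
          exact ⟨s, Finset.mem_insert_of_mem hs, hd⟩

/-- **Particles near ANY finite set of deep holes pay.**  For a `δ`-separated configuration `x`,
every finite set `H` of points off the configuration with `W_q(x) ≤ −98309653/125000000 − g`
(`g ≥ 0`) for each `q ∈ H` — no separation asked of `H` — and every `R ≥ 0`:
`N·e* + g/(2(R + 9/10)/δ+1)³ · #{j : x_j within R of H} ≤ 𝓔_LJ(x)` (a greedy `9/10`-net of `H`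
is paid by `holes_gap_near` at radius `R + 9/10`). [folklore] -/
theorem holes_gap_near_finset {N : ℕ} (x : Fin N → EuclideanSpace ℝ (Fin 3)) {δ R g : ℝ}
    (hδ : 0 < δ) (hR : 0 ≤ R) (hg : 0 ≤ g) (hsepx : ∀ i j : Fin N, i ≠ j → δ ≤ dist (x i) (x j))
    (H : Finset (EuclideanSpace ℝ (Fin 3))) (hoff : ∀ q ∈ H, ∀ i : Fin N, q ≠ x i)
    (hdeep : ∀ q ∈ H, ∑ i, lennardJones (dist q (x i)) ≤ -(98309653 / 125000000 : ℝ) - g) :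
    (N : ℝ) * (⨅ Q : PeriodicConfiguration 3, Q.energyPerParticle lennardJones) +
        g / (2 * (R + 9 / 10) / δ + 1) ^ 3 *
          (Nat.card {j : Fin N // ∃ q ∈ H, dist (x j) q ≤ R} : ℝ) ≤
      interactionEnergy lennardJones x := by
  classical
  obtain ⟨S, hSH, hsep, hcov⟩ := exists_separated_net H (by norm_num : (0 : ℝ) < 9 / 10)
  -- enumerate the net
  set m := S.card with hm
  set e := S.equivFin with he
  set p : Fin m → EuclideanSpace ℝ (Fin 3) := fun l => ((e.symm l : S) : EuclideanSpace ℝ (Fin 3))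
    with hp
  have hpmem : ∀ l, p l ∈ S := fun l => (e.symm l).2
  have hpsep : ∀ l l' : Fin m, l ≠ l' → (9 / 10 : ℝ) ≤ dist (p l) (p l') := fun l l' hll' =>
    hsep _ (hpmem l) _ (hpmem l') fun hq => hll' (e.symm.injective (Subtype.ext hq))
  have hpoff : ∀ (l : Fin m) (i : Fin N), p l ≠ x i := fun l i => hoff _ (hSH (hpmem l)) i
  have hpdeep : ∀ l : Fin m, ∑ i, lennardJones (dist (p l) (x i)) ≤
      -(98309653 / 125000000 : ℝ) - g := fun l => hdeep _ (hSH (hpmem l))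
  have hR' : 0 ≤ R + 9 / 10 := by linarith
  have h := holes_gap_near x hδ hR' hg hsepx p hpsep hpoff hpdeep
  -- every point of H is within 9/10 of the net
  have hmono : (Nat.card {j : Fin N // ∃ q ∈ H, dist (x j) q ≤ R} : ℝ) ≤
      (Nat.card {j : Fin N // ∃ l : Fin m, dist (x j) (p l) ≤ R + 9 / 10} : ℝ) := by
    rw [Nat.card_eq_fintype_card, Fintype.card_subtype, Nat.card_eq_fintype_card,
      Fintype.card_subtype]
    refine Nat.cast_le.2 (Finset.card_le_card fun j hj => ?_)
    simp only [Finset.mem_filter, Finset.mem_univ, true_and] at hj ⊢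
    obtain ⟨q, hq, hd⟩ := hj
    obtain ⟨s, hs, hds⟩ := hcov q hq
    refine ⟨e ⟨s, hs⟩, ?_⟩
    have hps : p (e ⟨s, hs⟩) = s := by simp [hp]
    rw [hps]
    linarith [dist_triangle (x j) q s]
  have hK : 0 ≤ g / (2 * (R + 9 / 10) / δ + 1) ^ 3 := by positivity
  nlinarith [mul_le_mul_of_nonneg_left hmono hK]

end Summit.AtomisticToContinuum.Crystallization.Theorems.PhononSlackCertificatesNearFarGlueR

end
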